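import Literature.AlgebraicGeometry.ShimuraVarieties.UnitaryShimuraCurveDescendedTower
import Literature.AlgebraicGeometry.ShimuraVarieties.UnitaryShimuraCanonicalModelComplexFibre
import Literature.NumberTheory.Transcendental.AnalytificationSeparatedProofs
import Literature.AlgebraicGeometry.Motives.RelativePeriods
import Literature.AlgebraicGeometry.Motives.HypersurfaceFieldPoints
import Literature.AlgebraicGeometry.HodgeTheory.HypersurfaceComplexPoints
import HarnessLib

/-!
# Complex points of the descended unitary Shimura curve: `M⋆_{K⋆}(ℂ) ≃ₜ Sh_{K⋆}(U(J⋆), 𝔻)(ℂ)`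

Topic `AlgebraicGeometry/ShimuraVarieties`, namespace `…ShimuraVarieties.UnitaryCanonicalModel` (continuation of ★
`UnitaryShimuraCurveDescendedTower`).  THEOREMS ONLY (no definition, no named fact, no instance, no `sorry`).  Cell `hodgecm-mathlib`,
road (ii) «embedded-curve descent» of the GS-3 census, piece 3/3, leaf **L3.4 F-PTS** of the cut
`A-provers/A-p10/CUT-R2-5-FIELDS.A-p10g7.md` §2: the field `pts` (and the shape of `map_pts`, `recip`) of the descended curve record.

LEVEL-WISE SETTING (the verbatim currency of ★ `RecordSystem.exists_descendedTower`): `R` the canonical model of the compact unitary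
Shimura SURFACE (★ `RecordSystem`), a frame `ᵗ(cB)·(a·H)·B = J⋆ ⊕ J⊥`, a curve level `K⋆` and a surface level `K` with `φGS(K⋆) ≤ K`,
and a closed `L`-immersion `j : Z ⟶ M_K` whose complexification has underlying image EXACTLY the Zariski closure
`C(K⋆, K) = closure {pt (emb P)}` of the embedded curve, `emb P := baseChangeEquiv τ M_K (pts_K⁻¹ (embPoints P))`.

* **`RecordSystem.exists_homeomorph_complexPoints_of_range_eq_closure_embPoints`** — if moreover every complex point of `(M_K)_τ` lying
  on `C(K⋆, K)` is an embedded point (`himg`, leaf L3.2), `embPoints` is injective (`hinj`, leaf R2-1) and `Sh_{K⋆}(ℂ)` is compact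
  (leaf L3.1), then there is a homeomorphism `e : Z(ℂ) ≃ₜ Sh_{K⋆}(U(J⋆), 𝔻)(ℂ)` with `j(e⁻¹ P) = pts_K⁻¹ (embPoints P)` for every `P`.
  Proof: `emb` is a continuous injection landing on `j_ℂ(Z_ℂ)`; lifting along the closed immersion `j_ℂ` (★ `AlgPoints.liftClosed`, a
  topological embedding ★ `AlgPoints.isEmbedding_map_of_isClosedImmersion`) gives a continuous bijection `Sh_{K⋆}(ℂ) → Z_ℂ(ℂ)` from a
  compact space to a Hausdorff one (★ `ComplexPoints.t2Space_of_isSeparated` for the projective `(M_K)_τ`), hence a homeomorphism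
  (Mathlib `Continuous.homeoOfEquivCompactToT2`); compose with `Z(ℂ) ≃ₜ Z_τ(ℂ)` (★ `AlgPoints.baseChangeEquiv`, continuous both ways).
* **`RecordSystem.homeomorph_map_transition_eq`** (shape of `map_pts`) — for two such levels and a transition `t : Z ⟶ Z′` over the
  surface transition (`t ≫ j′ = j ≫ M(f)`), `e′ (t (e⁻¹ [v, uK⋆])) = [v, uK⋆′]` (★ `RecordSystem.map_pts` + injectivity of `j′` on points).
* **`RecordSystem.smul_homeomorph_symm_mk`** (shape of `recip`) — Shimura reciprocity at the curve's CM points transported through `e`: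
  `σ • e⁻¹[τw, uK⋆] = e⁻¹[τw, d⋆·uK⋆]` for `σ ↔ s` Artin-correspondent and `d⋆` a diagonal twist of `s` at `w`
  (★ `RecordSystem.smul_ptsSymm_embPoints_mk` + ★ `AlgPoints.map_smul` + injectivity of `j` on points).

[Deligne1971TravauxShimura] §1.8, Prop. 1.15, Cor. 5.7, Variante 5.9; [Milne2005ShimuraVarieties] Lemma 5.13, Thm. 5.16, Thm. 13.6, Rem. 13.8.
HC_CM is proved only modulo the 7 printed citations until rung 0 closes; this file proves no cell binder.

## References
* [Deligne1971TravauxShimura] P. Deligne, *Travaux de Shimura* (1971), §1.8, Prop. 1.15 p. 132, Cor. 5.7 p. 156, Variante 5.9 p. 157.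
* [Milne2005ShimuraVarieties] J. S. Milne, *Introduction to Shimura varieties* (2005/2017), Lemma 5.13 p. 57, Thm. 5.16, Thm. 13.6 p. 118, Rem. 13.8.
* [ConradAdelicPoints2012] B. Conrad, *Weil and Grothendieck approaches to adelic points*, Prop. 2.1, Prop. 3.1.
* [Hartshorne1977] R. Hartshorne, *Algebraic Geometry*, II Ex. 2.7, II Ex. 3.11 (d).
-/

set_option autoImplicit false

noncomputable section

open Function Topology NumberField IsDedekindDomain CategoryTheory Matrix AlgebraicGeometry
open scoped Matrix ComplexOrder
open Literature.AlgebraicGeometry.Motives Literature.NumberTheory.Automorphic Literature.NumberTheory.Automorphic.UnitaryGroup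
open Literature.NumberTheory.Automorphic.Liu2021.AppendixC (C5.OpenCompactSubgroup C5.SmallLevel)
open Literature.Geometry.ComplexHyperbolic Literature.Geometry.ComplexHyperbolic.BallModel

namespace Literature.AlgebraicGeometry.ShimuraVarieties.UnitaryCanonicalModel

variable {L : Type} [Field L] [NumberField L] [IsCMField L]

omit [NumberField L] [IsCMField L] in
/-- Naturality of `X(ℂ) ≃ X_τ(ℂ)` (`AlgPoints.baseChangeEquiv`) in the `L`-scheme `X`: `(f ⊗ ℂ)(x_τ) = (f x)_τ` (verbatim twin of
the private lemma of ★ `UnitaryShimuraCurveDescendedTower`, kept private to spare an import). [folklore] -/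
private theorem map_baseChangeEquiv_eq {τ : L →+* ℂ} {X Y : SchemeOver L} (f : X ⟶ Y)
    (x : letI : Algebra L ℂ := τ.toAlgebra; ComplexPoints X) :
    letI : Algebra L ℂ := τ.toAlgebra
    AlgPoints.map ((Motives.baseChangeHom τ).map f) (AlgPoints.baseChangeEquiv τ X x) =
      AlgPoints.baseChangeEquiv τ Y (AlgPoints.map f x) := by
  letI : Algebra L ℂ := τ.toAlgebra
  symm
  rw [Equiv.apply_eq_iff_eq_symm_apply]
  apply Over.OverMorphism.ext
  rw [AlgPoints.baseChangeEquiv_symm_apply_left, AlgPoints.map_apply, Over.comp_left, AlgPoints.map_apply, Over.comp_left,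
    Category.assoc, baseChangeHom_map_left_comp_fst, ← Category.assoc, AlgPoints.baseChangeEquiv_apply_left_comp_fst]
  rfl

omit [NumberField L] [IsCMField L] in
/-- Naturality of `AlgPoints.baseChangeEquiv`, inverse form: `f (π_* Q) = π_* ((f ⊗ ℂ) Q)`. [folklore] -/
private theorem map_baseChangeEquiv_symm_eq {τ : L →+* ℂ} {X Y : SchemeOver L} (f : X ⟶ Y)
    (Q : ComplexPoints ((Motives.baseChangeHom τ).obj X)) :
    letI : Algebra L ℂ := τ.toAlgebra
    AlgPoints.map f ((AlgPoints.baseChangeEquiv τ X).symm Q) =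
      (AlgPoints.baseChangeEquiv τ Y).symm (AlgPoints.map ((Motives.baseChangeHom τ).map f) Q) := by
  letI : Algebra L ℂ := τ.toAlgebra
  rw [Equiv.eq_symm_apply, ← map_baseChangeEquiv_eq, Equiv.apply_symm_apply]

variable {Jstar : Matrix (Fin 2) (Fin 2) L} {τ : L →+* ℂ}
  {H : Matrix (Fin 3) (Fin 3) L} {T : GL (Fin 3) ℂ} {hT : formCongr (starRingEnd ℂ) T (H.map τ) = BallModel.J}
  {K₀' : C5.OpenCompactSubgroup ↥(finAdelic (↥(maximalRealSubfield L)) L (IsCMField.complexConj L) 3 H)}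
  (R : RecordSystem L H τ T hT K₀')
  (Jperp : Matrix (Fin 1) (Fin 1) L) (B : GL (Fin 3) L) {a : L} (ha : a ≠ 0)
  (hB : formCongr ((IsCMField.complexConj L : L ≃ₐ[↥(maximalRealSubfield L)] L) : L →+* L) B (a • H) = finSum 2 1 Jstar Jperp)
  (hτa : 0 < (τ a).re) (hτa' : (τ a).im = 0)

/-! ### §1 The homeomorphism `Z(ℂ) ≃ₜ Sh_{K⋆}(U(J⋆), 𝔻)(ℂ)` -/

section Points

variable (Kstar : Subgroup ↥(finAdelic (↥(maximalRealSubfield L)) L (IsCMField.complexConj L) 2 Jstar))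
  (K : C5.SmallLevel K₀') (hK : Kstar.map (φGS L Jstar Jperp H B ha hB) ≤ K.1.1)

set_option maxHeartbeats 400000 in -- instance-heavy adelic / Shimura-set statement: `whnf`/`isDefEq` time out at the default (as ★ `UnitaryShimuraCurveDescendedTower`)
/-- **L3.4 F-PTS — the complex points of the descended curve ARE the curve's Shimura set.**  Let `j : Z ⟶ M_K` be a closed
`L`-immersion whose complexification has underlying image the Zariski closure `C(K⋆, K)` of the embedded curve (★
`RecordSystem.exists_descendedTower`, levelwise), and assume: (`himg`) every complex point of `(M_K)_τ` on `C(K⋆, K)` is an embedded point,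
(`hinj`) `embPoints : Sh_{K⋆}(U(J⋆))(ℂ) → Sh_K(U(H))(ℂ)` is injective, and `Sh_{K⋆}(ℂ)` is compact.  Then there is a homeomorphism
`e : Z(ℂ) ≃ₜ Sh_{K⋆}(U(J⋆), 𝔻)(ℂ)` such that `j (e⁻¹ P) = pts_K⁻¹ (embPoints P)` for every `P` — the field `pts` of the curve's record
together with the compatibility making `j` the embedding on points.  (Lift `emb` along the closed immersion `j_ℂ`; a continuous bijection
from a compact space onto a Hausdorff one is a homeomorphism.) [cite: Deligne1971TravauxShimura, Prop. 1.15 p. 132, Cor. 5.7 p. 156]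
[cite: Milne2005ShimuraVarieties, Lemma 5.13 p. 57, Thm. 13.6 p. 118] [cite: ConradAdelicPoints2012, Prop. 2.1] -/
theorem RecordSystem.exists_homeomorph_complexPoints_of_range_eq_closure_embPoints
    {Z : SchemeOver L} (j : Z ⟶ R.M.obj K) [IsClosedImmersion j.left]
    (hrangeZ : letI : Algebra L ℂ := τ.toAlgebra
      Set.range ⇑((AbelianVariety.bcFunctor L ℂ).map j).left =
        closure (AlgPoints.pt '' Set.range fun P : ShimuraSetGS L Jstar τ Kstar =>
          AlgPoints.baseChangeEquiv τ (R.M.obj K) ((R.pts K).symm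
            (ShimuraSetGS.embPoints L H τ T hT Jstar Jperp B ha hB hτa hτa' Kstar K.1.1 hK P))))
    (himg : letI : Algebra L ℂ := τ.toAlgebra
      ∀ Q : ComplexPoints ((Motives.baseChangeHom τ).obj (R.M.obj K)),
        Q.pt ∈ closure (AlgPoints.pt '' Set.range fun P : ShimuraSetGS L Jstar τ Kstar =>
          AlgPoints.baseChangeEquiv τ (R.M.obj K) ((R.pts K).symm
            (ShimuraSetGS.embPoints L H τ T hT Jstar Jperp B ha hB hτa hτa' Kstar K.1.1 hK P))) →
        Q ∈ Set.range fun P : ShimuraSetGS L Jstar τ Kstar =>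
          AlgPoints.baseChangeEquiv τ (R.M.obj K) ((R.pts K).symm
            (ShimuraSetGS.embPoints L H τ T hT Jstar Jperp B ha hB hτa hτa' Kstar K.1.1 hK P)))
    (hinj : Injective (ShimuraSetGS.embPoints L H τ T hT Jstar Jperp B ha hB hτa hτa' Kstar K.1.1 hK))
    [CompactSpace (ShimuraSetGS L Jstar τ Kstar)] :
    letI : Algebra L ℂ := τ.toAlgebra
    ∃ e : ComplexPoints Z ≃ₜ ShimuraSetGS L Jstar τ Kstar,
      ∀ P : ShimuraSetGS L Jstar τ Kstar,
        AlgPoints.map j (e.symm P) =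
          (R.pts K).symm (ShimuraSetGS.embPoints L H τ T hT Jstar Jperp B ha hB hτa hτa' Kstar K.1.1 hK P) := by
  letI : Algebra L ℂ := τ.toAlgebra
  -- the embedded point of `P` in `(M_K)_τ(ℂ)`
  set emb : ShimuraSetGS L Jstar τ Kstar → ComplexPoints ((Motives.baseChangeHom τ).obj (R.M.obj K)) := fun P =>
    AlgPoints.baseChangeEquiv τ (R.M.obj K) ((R.pts K).symm
      (ShimuraSetGS.embPoints L H τ T hT Jstar Jperp B ha hB hτa hτa' Kstar K.1.1 hK P)) with hembdef
  have hembc : Continuous emb :=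
    (AlgPoints.continuous_baseChangeEquiv τ (R.M.obj K)).comp ((R.pts K).symm.continuous.comp
      (ShimuraSetGS.continuous_embPoints L H τ T hT Jstar Jperp B ha hB hτa hτa' Kstar K.1.1 hK))
  have hembi : Injective emb :=
    (AlgPoints.baseChangeEquiv τ (R.M.obj K)).injective.comp ((R.pts K).symm.injective.comp hinj)
  -- the complexified closed immersion `j_ℂ : Z_τ ⟶ (M_K)_τ`
  haveI hjℂ : IsClosedImmersion ((Motives.baseChangeHom τ).map j).left := Motives.SchemePair.isClosedImmersion_baseChangeHom_map_left τ j
  have hrange' : Set.range ⇑((Motives.baseChangeHom τ).map j).left = closure (AlgPoints.pt '' Set.range emb) := hrangeZ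
  -- every embedded point lies on `j_ℂ(Z_τ)`: lift it
  have hmem : ∀ P, (emb P).pt ∈ Set.range ⇑((Motives.baseChangeHom τ).map j).left := fun P => by
    rw [hrange']
    exact subset_closure ⟨emb P, ⟨P, rfl⟩, rfl⟩
  set g : ShimuraSetGS L Jstar τ Kstar → ComplexPoints ((Motives.baseChangeHom τ).obj Z) := fun P =>
    (emb P).liftClosed ((Motives.baseChangeHom τ).map j) (hmem P) with hgdef
  have hgmap : ∀ P, AlgPoints.map ((Motives.baseChangeHom τ).map j) (g P) = emb P := fun P =>
    AlgPoints.map_liftClosed _ _ _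
  have hjemb := AlgPoints.isEmbedding_map_of_isClosedImmersion (L := ℂ) ((Motives.baseChangeHom τ).map j)
  -- `g` is a continuous bijection
  have hgc : Continuous g := by
    rw [hjemb.continuous_iff]
    have h : AlgPoints.map ((Motives.baseChangeHom τ).map j) ∘ g = emb := funext hgmap
    rw [h]
    exact hembc
  have hgi : Injective g := fun P Q h => hembi (by rw [← hgmap P, ← hgmap Q, h])
  have hgs : Surjective g := fun Q => by
    have hQ : (AlgPoints.map ((Motives.baseChangeHom τ).map j) Q).pt ∈ closure (AlgPoints.pt '' Set.range emb) := by
      rw [← hrange']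
      exact AlgPoints.pt_map_mem_range _ Q
    obtain ⟨P, hP⟩ := himg _ hQ
    refine ⟨P, AlgPoints.map_injective_of_mono ((Motives.baseChangeHom τ).map j) ?_⟩
    rw [hgmap]
    exact hP
  -- `Z_τ(ℂ)` is Hausdorff: embedded by `j_ℂ` into `(M_K)_τ(ℂ)`, Hausdorff as `M_K` is projective
  haveI : IsProper ((Motives.baseChangeHom τ).obj (R.M.obj K)).hom := (R.projective_complexFibre K).isProper
  haveI : T2Space (ComplexPoints ((Motives.baseChangeHom τ).obj (R.M.obj K))) := ComplexPoints.t2Space_of_isSeparated _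
  haveI : T2Space (ComplexPoints ((Motives.baseChangeHom τ).obj Z)) := hjemb.t2Space
  -- the homeomorphisms `Sh_{K⋆}(ℂ) ≃ₜ Z_τ(ℂ)` (compact → Hausdorff) and `Z(ℂ) ≃ₜ Z_τ(ℂ)` (base change)
  let e₁ : ShimuraSetGS L Jstar τ Kstar ≃ₜ ComplexPoints ((Motives.baseChangeHom τ).obj Z) :=
    Continuous.homeoOfEquivCompactToT2 (f := Equiv.ofBijective g ⟨hgi, hgs⟩) hgc
  let e₀ : ComplexPoints Z ≃ₜ ComplexPoints ((Motives.baseChangeHom τ).obj Z) :=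
    { toEquiv := AlgPoints.baseChangeEquiv τ Z
      continuous_toFun := AlgPoints.continuous_baseChangeEquiv τ Z
      continuous_invFun := AlgPoints.continuous_baseChangeEquiv_symm τ Z }
  refine ⟨e₀.trans e₁.symm, fun P => ?_⟩
  -- `j (e⁻¹ P) = π_*(j_ℂ (g P)) = π_*(emb P) = pts_K⁻¹ (embPoints P)`
  have hsymm : (e₀.trans e₁.symm).symm P = (AlgPoints.baseChangeEquiv τ Z).symm (g P) := rfl
  rw [hsymm, map_baseChangeEquiv_symm_eq, hgmap, hembdef]
  exact (AlgPoints.baseChangeEquiv τ (R.M.obj K)).symm_apply_apply _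

end Points

/-! ### §2 Shapes of `map_pts` and `recip` for the descended curve, through the homeomorphisms of §1 -/

section Fields

set_option maxHeartbeats 400000 in -- instance-heavy adelic / Shimura-set statement (as ★ `UnitaryShimuraCurveDescendedTower`)
/-- **`map_pts` for the descended curve.**  For curve levels `K⋆ ≤ K⋆′` under surface levels `K ⟶ K′`, closed immersions
`j : Z ⟶ M_K`, `j′ : Z′ ⟶ M_{K′}`, a transition `t : Z ⟶ Z′` OVER the surface transition (`t ≫ j′ = j ≫ M(f)`, the naturality
clause of ★ `RecordSystem.exists_descendedTower`), and homeomorphisms `e, e′` as in §1 (`j (e⁻¹ P) = pts_K⁻¹ (embPoints P)`), the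
transition is `[v, uK⋆] ↦ [v, uK⋆′]` on complex points: `e′ (t (e⁻¹ [v, uK⋆])) = [v, uK⋆′]` — from the surface's ★ `RecordSystem.map_pts`
(`M(f)[z, bK] = [z, bK′]`), ★ `ShimuraSetGS.embPoints_mk` at both levels, and injectivity of `j′` on points (a closed immersion is a
monomorphism). [cite: Deligne1979ShimuraVarieties, 2.1.4] [cite: Milne2005ShimuraVarieties, Thm. 5.16 p. 59, §13 (60)–(62)] -/
theorem RecordSystem.homeomorph_map_transition_eq
    (Kstar Kstar' : Subgroup ↥(finAdelic (↥(maximalRealSubfield L)) L (IsCMField.complexConj L) 2 Jstar))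
    (K K' : C5.SmallLevel K₀') (f : K ⟶ K')
    (hK : Kstar.map (φGS L Jstar Jperp H B ha hB) ≤ K.1.1) (hK' : Kstar'.map (φGS L Jstar Jperp H B ha hB) ≤ K'.1.1)
    {Z Z' : SchemeOver L} (j : Z ⟶ R.M.obj K) (j' : Z' ⟶ R.M.obj K') [IsClosedImmersion j'.left]
    (t : Z ⟶ Z') (hnat : t ≫ j' = j ≫ R.M.map f)
    (e : letI : Algebra L ℂ := τ.toAlgebra; ComplexPoints Z ≃ₜ ShimuraSetGS L Jstar τ Kstar)
    (he : letI : Algebra L ℂ := τ.toAlgebra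
      ∀ P : ShimuraSetGS L Jstar τ Kstar, AlgPoints.map j (e.symm P) =
        (R.pts K).symm (ShimuraSetGS.embPoints L H τ T hT Jstar Jperp B ha hB hτa hτa' Kstar K.1.1 hK P))
    (e' : letI : Algebra L ℂ := τ.toAlgebra; ComplexPoints Z' ≃ₜ ShimuraSetGS L Jstar τ Kstar')
    (he' : letI : Algebra L ℂ := τ.toAlgebra
      ∀ P : ShimuraSetGS L Jstar τ Kstar', AlgPoints.map j' (e'.symm P) =
        (R.pts K').symm (ShimuraSetGS.embPoints L H τ T hT Jstar Jperp B ha hB hτa hτa' Kstar' K'.1.1 hK' P))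
    (v : Fin 2 → ℂ) (hv : v ∈ negCone (Jstar.map τ))
    (u : ↥(finAdelic (↥(maximalRealSubfield L)) L (IsCMField.complexConj L) 2 Jstar)) :
    letI : Algebra L ℂ := τ.toAlgebra
    e' (AlgPoints.map t (e.symm (ShimuraSetGS.mk L Jstar τ Kstar v hv u))) = ShimuraSetGS.mk L Jstar τ Kstar' v hv u := by
  letI : Algebra L ℂ := τ.toAlgebra
  suffices h : AlgPoints.map t (e.symm (ShimuraSetGS.mk L Jstar τ Kstar v hv u)) =
      e'.symm (ShimuraSetGS.mk L Jstar τ Kstar' v hv u) by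
    rw [h, Homeomorph.apply_symm_apply]
  apply AlgPoints.map_injective_of_mono j'
  rw [he', ← AlgPoints.map_comp_apply, hnat, AlgPoints.map_comp_apply, he]
  -- the surface transition on the two embedded classes (both are `[𝔹(B^τ(v ⊕ 0)), φGS(u)·]`)
  apply (R.pts K').injective
  rw [Homeomorph.apply_symm_apply, ShimuraSetGS.embPoints_mk, ShimuraSetGS.embPoints_mk]
  exact R.map_pts K K' f _ _

set_option maxHeartbeats 400000 in -- instance-heavy adelic / Shimura-set statement (as ★ `UnitaryShimuraCurveEmbeddedImageStable` §2)
/-- **`recip` for the descended curve.**  With `e` as in §1 (`j (e⁻¹ P) = pts_K⁻¹ (embPoints P)`), Shimura reciprocity at the curve's CM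
points holds on `Z(ℂ)`: for `σ ∈ Aut(ℂ/τL)` Artin-correspondent to the idele `s`, a rational negative vector `w` and a diagonal twist `d⋆`
of `recipFactor s` at `w` (★ `IsDiagTwistGS`), `σ • e⁻¹[τw, uK⋆] = e⁻¹[τw, d⋆·u K⋆]` — the surface's reciprocity read on embedded classes
(★ `RecordSystem.smul_ptsSymm_embPoints_mk`), `AlgPoints.map j` commuting with `σ` (★ `AlgPoints.map_smul`) and injective.
[cite: Milne2005ShimuraVarieties, (62) p. 114, Rem. 13.8 p. 119] [cite: Deligne1979ShimuraVarieties, 2.2.4–2.2.6] -/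
theorem RecordSystem.smul_homeomorph_symm_mk
    (Kstar : Subgroup ↥(finAdelic (↥(maximalRealSubfield L)) L (IsCMField.complexConj L) 2 Jstar))
    (K : C5.SmallLevel K₀') (hK : Kstar.map (φGS L Jstar Jperp H B ha hB) ≤ K.1.1)
    {Z : SchemeOver L} (j : Z ⟶ R.M.obj K) [IsClosedImmersion j.left]
    (e : letI : Algebra L ℂ := τ.toAlgebra; ComplexPoints Z ≃ₜ ShimuraSetGS L Jstar τ Kstar)
    (he : letI : Algebra L ℂ := τ.toAlgebra
      ∀ P : ShimuraSetGS L Jstar τ Kstar, AlgPoints.map j (e.symm P) =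
        (R.pts K).symm (ShimuraSetGS.embPoints L H τ T hT Jstar Jperp B ha hB hτa hτa' Kstar K.1.1 hK P))
    (σ : letI : Algebra L ℂ := τ.toAlgebra; ℂ ≃ₐ[L] ℂ)
    {s : (FiniteAdeleRing (𝓞 L) L)ˣ} (hs : letI : Algebra L ℂ := τ.toAlgebra; IsArtinCorrespondent L τ s σ.toRingEquiv)
    {w : Fin 2 → L} (hw : (fun i => τ (w i)) ∈ negCone (Jstar.map τ))
    {dstar : ↥(finAdelic (↥(maximalRealSubfield L)) L (IsCMField.complexConj L) 2 Jstar)}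
    (hd : IsDiagTwistGS L Jstar w (recipFactor L s) dstar)
    (u : ↥(finAdelic (↥(maximalRealSubfield L)) L (IsCMField.complexConj L) 2 Jstar)) :
    letI : Algebra L ℂ := τ.toAlgebra
    σ • e.symm (ShimuraSetGS.mk L Jstar τ Kstar (fun i => τ (w i)) hw u) =
      e.symm (ShimuraSetGS.mk L Jstar τ Kstar (fun i => τ (w i)) hw (dstar * u)) := by
  letI : Algebra L ℂ := τ.toAlgebra
  apply AlgPoints.map_injective_of_mono j
  rw [AlgPoints.map_smul, he, he]
  exact R.smul_ptsSymm_embPoints_mk Jperp B ha hB hτa hτa' Kstar K hK σ hs hw hd u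

end Fields

end Literature.AlgebraicGeometry.ShimuraVarieties.UnitaryCanonicalModel

end
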